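import Literature.Analysis.FluidPDE.OseenZoomCovariance
import Literature.Analysis.FluidPDE.OseenMildSlabChain
import Literature.Analysis.FluidPDE.TypeIAncientMild
import Literature.Analysis.FluidPDE.BoundedWeakIsometry
import Literature.Analysis.FluidPDE.SelfSimilarProofs
import HarnessLib

/-!
# Concatenation of per-period Oseen-mild solutions along the rotated self-similar zoom

Analysis/FluidPDE support file (everything proved; no definitions, no named facts).  The
**period-map picture** of (rotated) discretely self-similar Navier–Stokes dynamics
(Bradshaw–Tsai 2017, §1; Chae–Wolf 2017, Def. 1.1): a solution on the model period
`[−1, −c⁻²] × E` whose final slice, zoomed out by `𝒮⁻¹h = c⁻¹ R h(c⁻¹R⁻¹·)`, is the initial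
slice of the next model solution, concatenates — after zooming the `k`-th model solution in
`k` times, `(t, x) ↦ cᵏ (Rᵏ)⁻¹ f_k(c^{2k}(t − 1), cᵏ Rᵏ x)` on the physical slab
`[1 − c^{−2k}, 1 − c^{−2k−2}]` — to ONE Oseen-mild solution on `[0, 1) × E`
(`exists_concatenation_of_periodic_slabs`): jointly continuous, weakly divergence free,
satisfying the Oseen integral equation between all pairs of times (zoom covariance
`oseen_zoom` on each slab and the gluing `oseenMild_of_chain` across slabs), bounded on every
`[0, 1 − δ]`, and — if the model initial slices stay bounded below at one point `y₀` —
**unbounded** as `(t, x) → (1, 0)`: at `t_k = 1 − c^{−2k}`, `x_k = c^{−k}(Rᵏ)⁻¹y₀` the value is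
`cᵏ (Rᵏ)⁻¹ f_k(−1, y₀)`, of norm `≥ cᵏ m`.

## Mathlib / tree search

Tree: `oseen_zoom` (`OseenZoomCovariance`), `oseenMild_of_chain`,
`continuousOn_uncurry_Ico_of_chain`, `exists_bound_Icc_of_chain` (`OseenMildSlabChain`),
`oseenDuhamel_comp_sub_right`, `oseenDuhamel_congr_ae_slice`, `heatFlow_of_pos`,
`IsWeaklyDivFree.conj_linearIsometryEquiv`, `IsWeaklyDivFree.nsRescaleData`, `IsBoundedOn`.
Mathlib: the group `E ≃ₗᵢ[ℝ] E` (`LinearIsometryEquiv.coe_mul`, `inv_def`), `Nat.find`,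
`exists_pow_lt_of_lt_one`, `tendsto_pow_atTop_atTop_of_one_lt`.

## References

* Z. Bradshaw, T.-P. Tsai, *Forward discretely self-similar solutions of the Navier–Stokes
  equations II*, Ann. Henri Poincaré 18 (2017), §1 (DSS and the period map). [BradshawTsai2017AHP]
* Z. Bradshaw, T.-P. Tsai, *Rotationally corrected scaling invariant solutions to the
  Navier–Stokes equations*, Comm. PDE 42 (2017), §1 (RSS/RDSS fields). [BradshawTsai2017CPDE]
* D. Chae, J. Wolf, 2017, Def. 1.1 (rotated discrete self-similarity). [ChaeWolf2017]
* G. Koch, N. Nadirashvili, G. Seregin, V. Šverák, Acta Math. 203 (2009), §4 (4.4).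
  [KochNadirashviliSereginSverak2009]
-/

noncomputable section

open MeasureTheory Set Function Filter
open _root_.Topology

namespace Literature.Analysis.FluidPDE

variable {E : Type*} [NormedAddCommGroup E] [InnerProductSpace ℝ E] [FiniteDimensional ℝ E]
  [MeasurableSpace E] [BorelSpace E]

/-! ### One zoomed-in, time-shifted piece -/

/-- **The Oseen equation on a zoomed-in, time-shifted slab.** If `g` satisfies the Oseen
integral equation between all pairs of times of `[α, β]`, then the zoomed-in and shifted field
`(t, x) ↦ a L⁻¹ g(a²(t − 1), a L x)` (`a > 0`, `L` a linear isometry) satisfies it between all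
pairs `s < t` with `a²(s − 1), a²(t − 1) ∈ [α, β]` (`oseen_zoom` and the time-translation
covariance `oseenDuhamel_comp_sub_right`). [cite: KochNadirashviliSereginSverak2009, §1 (1.2) (arXiv p. 2)] -/
theorem oseen_zoom_shift {a : ℝ} (ha : 0 < a) (L : E ≃ₗᵢ[ℝ] E) {g : ℝ → E → E} {α β : ℝ}
    (hg : ∀ s t : ℝ, α ≤ s → s < t → t ≤ β → ∀ x,
      g t x = heatFlow (g s) (t - s) x - oseenDuhamel 1 s g g t x)
    {s t : ℝ} (hs : α ≤ a ^ 2 * (s - 1)) (hst : s < t) (ht : a ^ 2 * (t - 1) ≤ β) (y : E) :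
    a • L.symm (g (a ^ 2 * (t - 1)) (a • L y)) =
      heatFlow (fun x => a • L.symm (g (a ^ 2 * (s - 1)) (a • L x))) (t - s) y -
        oseenDuhamel 1 s (fun τ x => a • L.symm (g (a ^ 2 * (τ - 1)) (a • L x)))
          (fun τ x => a • L.symm (g (a ^ 2 * (τ - 1)) (a • L x))) t y := by
  have ha2 : 0 < a ^ 2 := by positivity
  have hst' : a ^ 2 * (s - 1) < a ^ 2 * (t - 1) := mul_lt_mul_of_pos_left (by linarith) ha2
  have hf : ∀ X, (fun τ => g (τ - a ^ 2)) (a ^ 2 * t) X =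
      UnboundedOperators.heatExtension ((fun τ => g (τ - a ^ 2)) (a ^ 2 * s))
          (a ^ 2 * t - a ^ 2 * s) X -
        oseenDuhamel 1 (a ^ 2 * s) (fun τ => g (τ - a ^ 2)) (fun τ => g (τ - a ^ 2))
          (a ^ 2 * t) X := by
    intro X
    have h1 := hg (a ^ 2 * (s - 1)) (a ^ 2 * (t - 1)) hs hst' ht X
    rw [heatFlow_of_pos _ (sub_pos.2 hst')] at h1
    have h2 := oseenDuhamel_comp_sub_right 1 (a ^ 2 * s) (a ^ 2 * t) (a ^ 2) g g X
    simp only at h2 ⊢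
    rw [h2, show a ^ 2 * t - a ^ 2 = a ^ 2 * (t - 1) by ring,
      show a ^ 2 * s - a ^ 2 = a ^ 2 * (s - 1) by ring,
      show a ^ 2 * t - a ^ 2 * s = a ^ 2 * (t - 1) - a ^ 2 * (s - 1) by ring]
    exact h1
  have key := oseen_zoom ha L (f := fun τ => g (τ - a ^ 2)) hst hf y
  have e : ∀ τ : ℝ, a ^ 2 * τ - a ^ 2 = a ^ 2 * (τ - 1) := fun τ => by ring
  simp only [e] at key
  rw [heatFlow_of_pos _ (sub_pos.2 hst)]
  exact key

omit [FiniteDimensional ℝ E] [MeasurableSpace E] [BorelSpace E] in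
/-- Joint continuity of a zoomed-in, time-shifted piece on the times mapped into the model
slab. [folklore] -/
theorem continuousOn_zoom_shift (a : ℝ) (L : E ≃ₗᵢ[ℝ] E) {g : ℝ → E → E} {α β : ℝ}
    (hg : ContinuousOn (uncurry g) (Icc α β ×ˢ univ)) {S : Set ℝ}
    (hS : ∀ t ∈ S, a ^ 2 * (t - 1) ∈ Icc α β) :
    ContinuousOn (uncurry fun t x => a • L.symm (g (a ^ 2 * (t - 1)) (a • L x))) (S ×ˢ univ) := by
  have hΨ : Continuous fun p : ℝ × E => (a ^ 2 * (p.1 - 1), a • L p.2) :=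
    ((continuous_const.mul (continuous_fst.sub continuous_const)).prodMk
      ((L.continuous.comp continuous_snd).const_smul a))
  have hmaps : MapsTo (fun p : ℝ × E => (a ^ 2 * (p.1 - 1), a • L p.2)) (S ×ˢ univ)
      (Icc α β ×ˢ univ) := fun p hp => ⟨hS p.1 hp.1, mem_univ _⟩
  have h1 : ContinuousOn (uncurry g ∘ fun p : ℝ × E => (a ^ 2 * (p.1 - 1), a • L p.2)) (S ×ˢ univ) :=
    hg.comp hΨ.continuousOn hmaps
  exact ((L.symm.continuous.const_smul a).comp_continuousOn h1 :)

/-- Weak divergence-freeness of a zoomed slice `x ↦ a L⁻¹ g(a L x)` (`a > 0`). [folklore] -/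
theorem isWeaklyDivFree_zoom_in {g : E → E} (hg : IsWeaklyDivFree g) {a : ℝ} (ha : 0 < a)
    (L : E ≃ₗᵢ[ℝ] E) : IsWeaklyDivFree (fun x => a • L.symm (g (a • L x))) := by
  have e : (fun x => a • L.symm (g (a • L x))) = nsRescaleData a (fun y => L.symm (g (L.symm.symm y))) := by
    funext x
    simp only [nsRescaleData_apply, LinearIsometryEquiv.symm_symm, LinearIsometryEquiv.map_smul]
  rw [e]
  exact IsWeaklyDivFree.nsRescaleData (hg.conj_linearIsometryEquiv L.symm) ha

/-! ### Powers of the zoom -/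

omit [InnerProductSpace ℝ E] [FiniteDimensional ℝ E] [MeasurableSpace E] [BorelSpace E] in
/-- `R^{k+1} x = R (Rᵏ x)` in the group of linear isometries. [folklore] -/
theorem linearIsometryEquiv_pow_succ_apply [NormedSpace ℝ E] (R : E ≃ₗᵢ[ℝ] E) (k : ℕ) (x : E) :
    (R ^ (k + 1)) x = R ((R ^ k) x) := by
  rw [pow_succ', LinearIsometryEquiv.coe_mul, comp_apply]

omit [InnerProductSpace ℝ E] [FiniteDimensional ℝ E] [MeasurableSpace E] [BorelSpace E] in
/-- `(R^{k+1})⁻¹ (R z) = (Rᵏ)⁻¹ z` in the group of linear isometries. [folklore] -/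
theorem linearIsometryEquiv_pow_succ_symm_apply [NormedSpace ℝ E] (R : E ≃ₗᵢ[ℝ] E) (k : ℕ)
    (z : E) : (R ^ (k + 1)).symm (R z) = (R ^ k).symm z := by
  rw [← LinearIsometryEquiv.inv_def, ← LinearIsometryEquiv.inv_def, pow_succ', mul_inv_rev,
    LinearIsometryEquiv.coe_mul, comp_apply]
  congr 1
  rw [LinearIsometryEquiv.inv_def, LinearIsometryEquiv.symm_apply_apply]

/-! ### The concatenation -/

/-- **Concatenation of per-period Oseen-mild solutions** (the period-map picture of rotated
discretely self-similar dynamics; Bradshaw–Tsai 2017, §1; Chae–Wolf 2017, Def. 1.1).  Let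
`c > 1`, `R` a linear isometry, and `f_k` (`k ∈ ℕ`) fields on the model period
`[−1, −c⁻²] × E`, each jointly continuous, bounded, weakly divergence free and Oseen-mild
between all pairs of model times, linked by the junction condition
`f_{k+1}(−1) = 𝒮⁻¹(f_k(−c⁻²))`, `𝒮⁻¹h = c⁻¹ R h(c⁻¹R⁻¹·)`, and with `‖f_k(−1, y₀)‖ ≥ m > 0`.
Then the concatenation `v(t, x) = cᵏ(Rᵏ)⁻¹f_k(c^{2k}(t − 1), cᵏRᵏx)` on
`t ∈ [1 − c^{−2k}, 1 − c^{−2k−2}]` is an Oseen-mild solution on `[0, 1)` with datum `f_0(−1)`: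
jointly continuous (the pieces match at the junction times), weakly divergence free, satisfying
the Oseen equation between all pairs `0 ≤ s < t < 1` (zoom covariance on each slab, gluing
across slabs), bounded on every `[0, 1 − δ]`, and unbounded as `(t, x) → (1, 0)`
(`‖v(1 − c^{−2k}, c^{−k}(Rᵏ)⁻¹y₀)‖ = cᵏ‖f_k(−1, y₀)‖ ≥ cᵏ m`). [cite: BradshawTsai2017CPDE, §1 (rotated discretely self-similar fields; the period map modulo rotation)] -/
theorem exists_concatenation_of_periodic_slabs {c : ℝ} (hc : 1 < c) (R : E ≃ₗᵢ[ℝ] E)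
    (f : ℕ → ℝ → E → E)
    (hcont : ∀ k, ContinuousOn (uncurry (f k)) (Icc (-1) (-(c ^ 2)⁻¹) ×ˢ univ))
    (hbd : ∀ k, ∃ M : ℝ, ∀ t ∈ Icc (-1 : ℝ) (-(c ^ 2)⁻¹), ∀ x, ‖f k t x‖ ≤ M)
    (hdiv : ∀ k, ∀ t ∈ Icc (-1 : ℝ) (-(c ^ 2)⁻¹), IsWeaklyDivFree (f k t))
    (hoseen : ∀ k, ∀ s t : ℝ, -1 ≤ s → s < t → t ≤ -(c ^ 2)⁻¹ → ∀ x,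
      f k t x = heatFlow (f k s) (t - s) x - oseenDuhamel 1 s (f k) (f k) t x)
    (hjump : ∀ k y, f (k + 1) (-1) y = c⁻¹ • R (f k (-(c ^ 2)⁻¹) (c⁻¹ • R.symm y)))
    (y₀ : E) {m : ℝ} (hm : 0 < m) (hmk : ∀ k, m ≤ ‖f k (-1) y₀‖) :
    ∃ v : ℝ → E → E, v 0 = f 0 (-1) ∧
      ContinuousOn (uncurry v) (Ico 0 1 ×ˢ univ) ∧
      (∀ t ∈ Ico (0 : ℝ) 1, IsWeaklyDivFree (v t)) ∧
      (∀ s t : ℝ, 0 ≤ s → s < t → t < 1 → ∀ x,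
        v t x = heatFlow (v s) (t - s) x - oseenDuhamel 1 s v v t x) ∧
      (∀ δ : ℝ, 0 < δ → IsBoundedOn (Icc 0 (1 - δ)) v) ∧
      (∀ K δ : ℝ, 0 < δ → ∃ t ∈ Ico (0 : ℝ) 1, ∃ x : E, 1 - δ < t ∧ ‖x‖ < δ ∧ K < ‖v t x‖) := by
  classical
  have hc0 : 0 < c := one_pos.trans hc
  have hc2 : 0 < c ^ 2 := by positivity
  set q : ℝ := (c ^ 2)⁻¹ with hq
  have hq0 : 0 < q := inv_pos.2 hc2
  have hq1 : q < 1 := inv_lt_one_of_one_lt₀ (by nlinarith)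
  have hcq : c ^ 2 * q = 1 := mul_inv_cancel₀ hc2.ne'
  have hβ : ∀ k : ℕ, (c ^ k) ^ 2 = (c ^ 2) ^ k := fun k => by rw [← pow_mul, ← pow_mul, mul_comm]
  have hβq : ∀ k : ℕ, (c ^ 2) ^ k * q ^ k = 1 := fun k => by rw [← mul_pow, hcq, one_pow]
  -- the slab ends `T k = 1 - q^k`
  set T : ℕ → ℝ := fun k => 1 - q ^ k with hT
  have hT0 : T 0 = 0 := by simp [hT]
  have hTlt : ∀ k, T k < T (k + 1) := fun k => by
    simp only [hT]
    have h : q ^ k * q < q ^ k := mul_lt_of_lt_one_right (pow_pos hq0 k) hq1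
    rw [pow_succ]
    linarith
  have hTmono : Monotone T := monotone_nat_of_le_succ fun k => (hTlt k).le
  have hT1 : ∀ k, T k < 1 := fun k => by simp only [hT]; linarith [pow_pos hq0 k]
  have hTlim : ∀ t < 1, ∃ n, t < T n := fun t ht => by
    obtain ⟨n, hn⟩ := exists_pow_lt_of_lt_one (sub_pos.2 ht) hq1
    exact ⟨n, by simp only [hT]; linarith⟩
  have hstart : ∀ k : ℕ, (c ^ k) ^ 2 * (T k - 1) = -1 := fun k => by
    rw [hβ k]; simp only [hT]
    rw [show (1 : ℝ) - q ^ k - 1 = -(q ^ k) by ring, mul_neg, hβq]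
  have hend : ∀ k : ℕ, (c ^ k) ^ 2 * (T (k + 1) - 1) = -q := fun k => by
    rw [hβ k]; simp only [hT]
    rw [show (1 : ℝ) - q ^ (k + 1) - 1 = -(q ^ k * q) by ring, mul_neg, ← mul_assoc, hβq, one_mul]
  have hmodel : ∀ k, ∀ t ∈ Icc (T k) (T (k + 1)), (c ^ k) ^ 2 * (t - 1) ∈ Icc (-1 : ℝ) (-q) := by
    intro k t ht
    have hpos : 0 ≤ (c ^ k) ^ 2 := by positivity
    refine ⟨?_, ?_⟩
    · rw [← hstart k]; exact mul_le_mul_of_nonneg_left (by linarith [ht.1]) hpos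
    · rw [← hend k]; exact mul_le_mul_of_nonneg_left (by linarith [ht.2]) hpos
  -- the pieces
  set P : ℕ → ℝ → E → E := fun k t x =>
    c ^ k • (R ^ k).symm (f k ((c ^ k) ^ 2 * (t - 1)) (c ^ k • (R ^ k) x)) with hP
  have hjunction : ∀ k x, P (k + 1) (T (k + 1)) x = P k (T (k + 1)) x := by
    intro k x
    simp only [hP]
    rw [hstart (k + 1), hend k, hjump]
    have e3 : c⁻¹ • R.symm (c ^ (k + 1) • (R ^ (k + 1)) x) = c ^ k • (R ^ k) x := by
      rw [LinearIsometryEquiv.map_smul, smul_smul, linearIsometryEquiv_pow_succ_apply,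
        LinearIsometryEquiv.symm_apply_apply, pow_succ', ← mul_assoc, inv_mul_cancel₀ hc0.ne',
        one_mul]
    rw [e3, LinearIsometryEquiv.map_smul, linearIsometryEquiv_pow_succ_symm_apply, smul_smul,
      pow_succ, mul_assoc, mul_inv_cancel₀ hc0.ne', mul_one]
  -- the concatenated field
  have hex : ∀ t < (1 : ℝ), ∃ k, t < T (k + 1) := fun t ht =>
    (hTlim t ht).imp fun n hn => hn.trans_le (hTmono (Nat.le_succ n))
  let idx : ℝ → ℕ := fun t => if h : t < 1 then Nat.find (hex t h) else 0
  let v : ℝ → E → E := fun t x => P (idx t) t x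
  have hidx : ∀ k, ∀ t ∈ Ico (T k) (T (k + 1)), idx t = k := by
    intro k t ht
    have ht1 : t < 1 := ht.2.trans (hT1 _)
    simp only [idx, dif_pos ht1]
    rw [Nat.find_eq_iff]
    refine ⟨ht.2, fun j hj hlt => ?_⟩
    exact absurd (hlt.trans_le ((hTmono (Nat.succ_le_of_lt hj)).trans ht.1)) (lt_irrefl t)
  have hv_eq : ∀ k, ∀ t ∈ Icc (T k) (T (k + 1)), ∀ x, v t x = P k t x := by
    intro k t ht x
    rcases ht.2.lt_or_eq with hlt | heq
    · simp only [v, hidx k t ⟨ht.1, hlt⟩]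
    · rw [heq]
      simp only [v, hidx (k + 1) (T (k + 1)) ⟨le_rfl, hTlt (k + 1)⟩]
      exact hjunction k x
  have hcover : ∀ t, 0 ≤ t → t < 1 → ∃ k, t ∈ Ico (T k) (T (k + 1)) := by
    intro t ht0 ht1
    have hex' : ∃ n, t < T n := hTlim t ht1
    have hn₀ : t < T (Nat.find hex') := Nat.find_spec hex'
    have hpos : Nat.find hex' ≠ 0 := fun h => by rw [h, hT0] at hn₀; linarith
    obtain ⟨k, hk⟩ := Nat.exists_eq_add_one_of_ne_zero hpos
    refine ⟨k, ⟨?_, by rw [hk] at hn₀; exact hn₀⟩⟩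
    by_contra hlt
    exact Nat.find_min hex' (show k < Nat.find hex' by omega) (not_le.1 hlt)
  -- per-slab properties of `v`
  have hvcont : ∀ k, ContinuousOn (uncurry v) (Icc (T k) (T (k + 1)) ×ˢ univ) := fun k =>
    (continuousOn_zoom_shift (c ^ k) (R ^ k) (hcont k) (hmodel k)).congr
      fun p hp => hv_eq k p.1 hp.1 p.2
  have hvbd : ∀ k, ∃ M : ℝ, ∀ τ ∈ Icc (T k) (T (k + 1)), ∀ y, ‖v τ y‖ ≤ M := by
    intro k
    obtain ⟨M, hM⟩ := hbd k
    refine ⟨c ^ k * M, fun τ hτ y => ?_⟩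
    rw [hv_eq k τ hτ y]
    simp only [hP]
    rw [norm_smul, Real.norm_of_nonneg (pow_pos hc0 k).le, LinearIsometryEquiv.norm_map]
    exact mul_le_mul_of_nonneg_left (hM _ (hmodel k τ hτ) _) (pow_pos hc0 k).le
  have hvslab : ∀ k, ∀ s t : ℝ, T k ≤ s → s < t → t ≤ T (k + 1) → ∀ x,
      v t x = heatFlow (v s) (t - s) x - oseenDuhamel 1 s v v t x := by
    intro k s t hs hst ht x
    have hsI : s ∈ Icc (T k) (T (k + 1)) := ⟨hs, hst.le.trans ht⟩
    have htI : t ∈ Icc (T k) (T (k + 1)) := ⟨hs.trans hst.le, ht⟩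
    have hvs : v s = P k s := funext fun y => hv_eq k s hsI y
    have hB : oseenDuhamel 1 s v v t x = oseenDuhamel 1 s (P k) (P k) t x :=
      oseenDuhamel_congr_ae_slice
        (fun τ hτ => Eventually.of_forall fun y =>
          hv_eq k τ ⟨hs.trans hτ.1.le, hτ.2.le.trans ht⟩ y)
        (fun τ hτ => Eventually.of_forall fun y =>
          hv_eq k τ ⟨hs.trans hτ.1.le, hτ.2.le.trans ht⟩ y) x
    rw [hv_eq k t htI x, hvs, hB]
    exact oseen_zoom_shift (pow_pos hc0 k) (R ^ k) (hoseen k) (hmodel k s hsI).1 hst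
      (hmodel k t htI).2 x
  refine ⟨v, ?_, ?_, ?_, ?_, ?_, ?_⟩
  · -- the datum
    funext x
    have h := hv_eq 0 (T 0) ⟨le_rfl, (hTlt 0).le⟩ x
    rw [hT0] at h
    rw [h]
    simp only [hP, pow_zero, one_smul, one_pow, one_mul, zero_sub, ← LinearIsometryEquiv.inv_def,
      inv_one, LinearIsometryEquiv.coe_one, id_eq]
  · -- joint continuity on `[0, 1) × E`
    have h := continuousOn_uncurry_Ico_of_chain hTmono hvcont (L := 1) hTlim
    rwa [hT0] at h
  · -- weakly divergence free
    intro t ht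
    obtain ⟨k, hk⟩ := hcover t ht.1 ht.2
    have hvt : v t = P k t := funext fun y => hv_eq k t (Ico_subset_Icc_self hk) y
    rw [hvt]
    exact isWeaklyDivFree_zoom_in (hdiv k _ (hmodel k t (Ico_subset_Icc_self hk))) (pow_pos hc0 k)
      (R ^ k)
  · -- the Oseen equation between all pairs
    have h := oseenMild_of_chain hTmono hvcont hvbd hvslab (L := 1) hTlim
    rw [hT0] at h
    exact h
  · -- bounded on `[0, 1 - δ]`
    intro δ hδ
    obtain ⟨n, hn⟩ := hTlim (1 - δ) (by linarith)
    obtain ⟨M, hM⟩ := exists_bound_Icc_of_chain hTmono hvbd hn.le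
    rw [hT0] at hM
    exact ⟨M, hM⟩
  · -- unbounded as `(t, x) → (1, 0)`
    intro K δ hδ
    have h1 : Tendsto (fun k : ℕ => c ^ k) atTop atTop := tendsto_pow_atTop_atTop_of_one_lt hc
    have h2 : Tendsto (fun k : ℕ => q ^ k) atTop (𝓝 0) :=
      tendsto_pow_atTop_nhds_zero_of_lt_one hq0.le hq1
    have h3 : Tendsto (fun k : ℕ => (c ^ k)⁻¹) atTop (𝓝 0) := tendsto_inv_atTop_zero.comp h1
    have hy : 0 < δ / (‖y₀‖ + 1) := by positivity
    obtain ⟨k, hk1, hk2, hk3⟩ := ((h1.eventually_gt_atTop (K / m)).and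
      ((h2.eventually (gt_mem_nhds hδ)).and (h3.eventually (gt_mem_nhds hy)))).exists
    have hck : 0 < c ^ k := pow_pos hc0 k
    refine ⟨T k, ⟨by rw [← hT0]; exact hTmono (Nat.zero_le k), hT1 k⟩,
      (c ^ k)⁻¹ • (R ^ k).symm y₀, ?_, ?_, ?_⟩
    · simp only [hT]; linarith
    · rw [norm_smul, norm_inv, Real.norm_of_nonneg hck.le, LinearIsometryEquiv.norm_map]
      calc (c ^ k)⁻¹ * ‖y₀‖ ≤ (c ^ k)⁻¹ * (‖y₀‖ + 1) := by gcongr; linarith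
        _ < δ / (‖y₀‖ + 1) * (‖y₀‖ + 1) := by gcongr
        _ = δ := div_mul_cancel₀ δ (by positivity)
    · rw [hv_eq k (T k) ⟨le_rfl, (hTlt k).le⟩]
      simp only [hP]
      rw [hstart k, LinearIsometryEquiv.map_smul, smul_smul, mul_inv_cancel₀ hck.ne', one_smul,
        LinearIsometryEquiv.apply_symm_apply, norm_smul, Real.norm_of_nonneg hck.le,
        LinearIsometryEquiv.norm_map]
      have hK : K < c ^ k * m := by
        have := (div_lt_iff₀ hm).1 hk1
        linarith
      exact hK.trans_le (mul_le_mul_of_nonneg_left (hmk k) hck.le)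

end Literature.Analysis.FluidPDE

end
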